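import Summits.Ventures.YMGap.FlowData.CircleSpectralResolution
import HarnessLib

/-!
# Venture YMGap, track Y3 FLOW-DATA — the d = 2 EQUALITY `E₁((ℤ/L)¹; β) = L·(−ln u(β))` for the typed SU(2) tube
# objects: `‖T ∘ P_{ê₀}‖ = λ^L` exactly (theorems only)

HONEST FRAMING: venture file of the cell `pub-ymgap` (QuantumFields programme), track Y3; companion THEOREMS for
`FlowData/TorelonEnergy.lean`, `FlowData/TwoDimTorelonBound.lean` and `Conjectures/TubeStringTension.lean` (file 4/4
of the d = 2 equality chain).  The typed law «L-Y3-σ» says `E₁ < L·(−ln u)`; its module docstring records that in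
slice dimension `k = 1` (theory dimension two) the law degenerates to an EQUALITY.  `TwoDimTorelonBound` proved `≤`
(«equality needs Peter–Weyl»); this file proves `≥` and hence the equality WITHOUT Peter–Weyl, for the cell's ACTUAL
typed objects (`J = β_W/2`, twist `−1`, `u = I₂/I₁`, `E₁ = log ‖T‖ − log ‖T ∘ P_{ê₀}‖`) — a STEP-0-style theorem:
the typed objects reproduce the exactly solvable two-dimensional value on every finite circle.

* `norm_sq_eq_tsum_of_hasSum_orthonormal` — Parseval for a resolved vector;
* `norm_tubeTransferOperator_apply_le_of_odd` — on the odd sector `C_{ê₀}ψ = −ψ`: `‖Tψ‖ ≤ (c₁(β)/2)^L ‖ψ‖` (only odd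
  `n` survive, `c_n/(n+1) = 2I_{n+1}/β ≤ 2I₂/β = c₁/2` by Bessel order monotonicity, Parseval and Bessel's
  inequality);
* **`su2_tubeSectorNorm_sliceOne_le`** / **`su2_tubeSectorNorm_sliceOne_eq`** — `‖T ∘ P_{ê₀}‖ = λ^L`,
  `λ = ∫ e^{βa₀} a₀ = c₁(β)/2` the Schur scalar (`su2_schurScalar_eq_besselISub`; `≥` is
  `TwoDimTorelonBound.pow_schurScalar_le_tubeSectorNorm_sliceOne`);
* **`su2TorelonEnergy_sliceOne_eq`**: `su2TorelonEnergy β 1 L 0 = L · (−log (su2CharacterRatio β))` for every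
  `L ≥ 1`, `β > 0`; `tubeTransferOperator_holCharacter`: `T φ_n = (c_n/(n+1))^L φ_n` (every character an eigenvector);
  `su2TorelonEnergy_sliceOne_not_lt`: at `k = 1` the strict law is false at every point (the law is a `k = 2` statement).
Finite circles `(ℤ/L)¹` only; no number, no row, nothing about limits, `k ≥ 2` or a mass gap.

References: A. A. Migdal, Sov. Phys. JETP 42 (1975) 413; I. Montvay, G. Münster (1994) §3.2.6
[cite: MontvayMunster1994, §3.2.6]; M. Reed, B. Simon I (1980) Thm. II.6 [cite: ReedSimonI1980, Thm. II.6].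
-/

noncomputable section

open scoped BigOperators Topology
open MeasureTheory Filter Function Set Polynomial.Chebyshev
open Literature.MathematicalPhysics.QuantumFieldTheory Literature.MathematicalPhysics.QuantumLattice Literature.Analysis.FunctionSpaces
open Summit.Ventures.LatticeQCDFlow.Exactness Summit.Ventures.LatticeQCDFlow.Scoring

namespace Summit.Ventures.YMGap.FlowData

/-! ### The odd sector: `‖T ∘ P_{ê₀}‖ ≤ λ^L`, equality, and `E₁ = L·(−ln u)` -/

section Equality

open Literature.MathematicalPhysics.QuantumLattice (fundamentalRep continuous_fundamentalRep fundamentalRep_mem_unitaryGroup)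
open Summit.Ventures.YMGap.Conjectures (su2CharacterRatio su2CharacterRatio_pos)

variable {L : ℕ} [NeZero L]

/-- **Parseval for the resolved vector**: if `T ψ = Σ_n a_n φ_n` with the `φ_n` orthonormal and the series summable,
`‖T ψ‖² = Σ_n a_n²`. [cite: ReedSimonI1980, Thm. II.6] -/
theorem norm_sq_eq_tsum_of_hasSum_orthonormal {H : Type*} [NormedAddCommGroup H] [InnerProductSpace ℝ H]
    {Φ : ℕ → H} (hΦ : Orthonormal ℝ Φ) {a : ℕ → ℝ} {x : H}
    (hx : HasSum (fun n => a n • Φ n) x) : ‖x‖ ^ 2 = ∑' n, a n ^ 2 := by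
  have hcoef : ∀ n, @inner ℝ _ _ (Φ n) x = a n := by
    intro n
    have h := (hx.mapL (innerSL ℝ (Φ n))).tsum_eq
    simp only [innerSL_apply_apply, real_inner_smul_right] at h
    rw [← h, tsum_eq_single n]
    · rw [orthonormal_iff_ite.1 hΦ, if_pos rfl, mul_one]
    · intro m hm
      rw [orthonormal_iff_ite.1 hΦ, if_neg hm.symm, mul_zero]
  have h := (hx.mapL (innerSL ℝ x)).tsum_eq
  simp only [innerSL_apply_apply, real_inner_smul_right] at h
  rw [← real_inner_self_eq_norm_sq, ← h]
  refine tsum_congr fun n => ?_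
  rw [real_inner_comm, hcoef, sq]

/-- `χ_n` eigenvalues on the odd list are bounded by the Schur scalar: `c_n(β)/(n+1) ≤ c₁(β)/2` for odd `n`
(indeed for all `n ≥ 1`; Bessel order monotonicity `I_{n+1} ≤ I₂`). [cite: DLMF, 10.37] -/
theorem besselISub_div_succ_le_one {β : ℝ} (hβ : 0 < β) {n : ℕ} (hn : 1 ≤ n) :
    (besselI n β - besselI (n + 2) β) / (n + 1) ≤ (besselI 1 β - besselI 3 β) / 2 := by
  have h := besselISub_div_succ_antitone hβ hn
  norm_num at h
  exact h

/-- **The circle transfer operator on the odd sector**: if `C_{ê₀} ψ = −ψ` then `‖T ψ‖ ≤ (c₁(β)/2)^L ‖ψ‖`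
(only odd characters see `ψ`; Parseval and Bessel's inequality). [cite: MontvayMunster1994, §3.2.6] -/
theorem norm_tubeTransferOperator_apply_le_of_odd {β : ℝ} (hβ : 0 < β)
    {ψ : Lp ℝ 2 (sliceMeasure (Matrix.specialUnitaryGroup (Fin 2) ℂ) 1 L)}
    (hψ : fluxTwistOp 1 L su2MinusOne (Pi.single 0 1) ψ = -ψ) :
    ‖tubeTransferOperator (fundamentalRep (Fin 2)) (β / 2) 1 L ψ‖ ≤ ((besselI 1 β - besselI 3 β) / 2) ^ L * ‖ψ‖ := by
  set ev : ℕ → ℝ := fun n => ((besselI n β - besselI (n + 2) β) / (n + 1)) ^ L with hev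
  set lam : ℝ := ((besselI 1 β - besselI 3 β) / 2) ^ L with hlam
  set Φ : ℕ → Lp ℝ 2 (sliceMeasure (Matrix.specialUnitaryGroup (Fin 2) ℂ) 1 L) := fun n =>
    (memLp_holCharacter (L := L) n).toLp _ with hΦ
  have hΦon : Orthonormal ℝ Φ := orthonormal_holCharacter (L := L)
  have hx := hasSum_tubeTransferOperator_sliceOne (L := L) hβ ψ
  change HasSum (fun n => (ev n * @inner ℝ _ _ (Φ n) ψ) • Φ n) _ at hx
  have hlam0 : 0 ≤ (besselI 1 β - besselI 3 β) / 2 := by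
    have h := besselISub_nonneg hβ.le 1
    norm_num at h ⊢
    linarith
  -- the coefficients vanish on even `n` and are bounded by `lam · |⟪φ_n, ψ⟫|` on odd `n`
  have hcoef : ∀ n, (ev n * @inner ℝ _ _ (Φ n) ψ) ^ 2 ≤ lam ^ 2 * ‖@inner ℝ _ _ (Φ n) ψ‖ ^ 2 := by
    intro n
    rcases Nat.even_or_odd n with hn | hn
    · rw [inner_holCharacter_eq_zero_of_odd (L := L) hn hψ, mul_zero, norm_zero]
      simp
    · have h1 : 1 ≤ n := by
        rcases hn with ⟨m, rfl⟩
        omega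
      have hevle : ev n ≤ lam :=
        pow_le_pow_left₀ (div_nonneg (besselISub_nonneg hβ.le n) (by positivity)) (besselISub_div_succ_le_one hβ h1) L
      rw [mul_pow, Real.norm_eq_abs, sq_abs]
      exact mul_le_mul_of_nonneg_right (pow_le_pow_left₀ (eigenvalue_sliceOne_nonneg hβ.le n) hevle 2) (sq_nonneg _)
  have hB := hΦon.tsum_inner_products_le ψ
  have hBs := hΦon.inner_products_summable ψ
  have hsq : ‖tubeTransferOperator (fundamentalRep (Fin 2)) (β / 2) 1 L ψ‖ ^ 2 ≤ (lam * ‖ψ‖) ^ 2 := by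
    rw [norm_sq_eq_tsum_of_hasSum_orthonormal hΦon hx]
    calc ∑' n, (ev n * @inner ℝ _ _ (Φ n) ψ) ^ 2 ≤ ∑' n, lam ^ 2 * ‖@inner ℝ _ _ (Φ n) ψ‖ ^ 2 :=
          Summable.tsum_le_tsum hcoef (Summable.of_nonneg_of_le (fun n => sq_nonneg _) hcoef (hBs.mul_left _))
            (hBs.mul_left _)
      _ = lam ^ 2 * ∑' n, ‖@inner ℝ _ _ (Φ n) ψ‖ ^ 2 := tsum_mul_left
      _ ≤ lam ^ 2 * ‖ψ‖ ^ 2 := mul_le_mul_of_nonneg_left hB (sq_nonneg _)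
      _ = (lam * ‖ψ‖) ^ 2 := by ring
  exact (pow_le_pow_iff_left₀ (norm_nonneg _) (mul_nonneg (pow_nonneg hlam0 L) (norm_nonneg _)) two_ne_zero).1 hsq

/-- The range of `P_{ê₀}` is the odd sector: `C_{ê₀} (P_{ê₀} χ) = −P_{ê₀} χ`. [cite: tHooft1979Flux] -/
theorem fluxTwistOp_tubeFluxProjection_single (χ : Lp ℝ 2 (sliceMeasure (Matrix.specialUnitaryGroup (Fin 2) ℂ) 1 L)) :
    fluxTwistOp 1 L su2MinusOne (Pi.single 0 1) (tubeFluxProjection su2MinusOne 1 L (Pi.single 0 1) χ) =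
      -tubeFluxProjection su2MinusOne 1 L (Pi.single 0 1) χ := by
  have h := fluxTwistOp_comp_tubeFluxProjection (k := 1) (L := L) su2MinusOne su2MinusOne_mul_self
    (Pi.single 0 1) (Pi.single 0 1)
  have hsign : fluxSign (Pi.single (0 : Fin 1) (1 : ZMod 2)) (Pi.single 0 1) = -1 := by
    unfold fluxSign
    rw [Fin.prod_univ_one, Pi.single_eq_same, if_pos ⟨rfl, rfl⟩]
  rw [hsign] at h
  have h2 := congrArg (fun A => A χ) h
  simpa using h2

/-- **`‖T ∘ P_{ê₀}‖ ≤ (c₁(β)/2)^L` on the circle** (the missing upper bound on the flux sector).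
[cite: MontvayMunster1994, §3.2.6] -/
theorem su2_tubeSectorNorm_sliceOne_le {β : ℝ} (hβ : 0 < β) :
    tubeSectorNorm (fundamentalRep (Fin 2)) su2MinusOne (β / 2) 1 L (Pi.single 0 1) ≤
      ((besselI 1 β - besselI 3 β) / 2) ^ L := by
  have hlam0 : 0 ≤ (besselI 1 β - besselI 3 β) / 2 := by
    have h := besselISub_nonneg hβ.le 1
    norm_num at h ⊢
    linarith
  show ‖(tubeTransferOperator (fundamentalRep (Fin 2)) (β / 2) 1 L).comp
      (tubeFluxProjection su2MinusOne 1 L (Pi.single 0 1))‖ ≤ _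
  refine ContinuousLinearMap.opNorm_le_bound _ (pow_nonneg hlam0 L) fun χ => ?_
  rw [ContinuousLinearMap.comp_apply]
  have h1 := norm_tubeTransferOperator_apply_le_of_odd (L := L) hβ (fluxTwistOp_tubeFluxProjection_single χ)
  have h2 : ‖tubeFluxProjection su2MinusOne 1 L (Pi.single 0 1) χ‖ ≤ ‖χ‖ := by
    have h := (tubeFluxProjection su2MinusOne 1 L (Pi.single 0 1)).le_opNorm χ
    exact h.trans (mul_le_of_le_one_left (norm_nonneg _) (norm_tubeFluxProjection_le_one _ 1 L _))
  exact h1.trans (mul_le_mul_of_nonneg_left h2 (pow_nonneg hlam0 L))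

/-- **The Schur scalar of `SU(2)` in Bessel form**: `∫ e^{β a₀} a₀ dU = c₁(β)/2 = (I₁(β) − I₃(β))/2` (`β ≥ 0`).
[cite: DLMF, 10.32.3] -/
theorem su2_schurScalar_eq_besselISub {β : ℝ} (hβ : 0 ≤ β) :
    ∫ U : Matrix.specialUnitaryGroup (Fin 2) ℂ, Real.exp (2 * (β / 2) * su2a0 U) * su2a0 U
        ∂haarProbability (Matrix.specialUnitaryGroup (Fin 2) ℂ) = (besselI 1 β - besselI 3 β) / 2 := by
  have h := integral_weight_mul_su2Character hβ 1 1 1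
  simp only [one_mul, mul_one, su2a0_inv, U_one, Polynomial.eval_mul, Polynomial.eval_ofNat, Polynomial.eval_X,
    Nat.cast_one] at h
  rw [show 2 * (β / 2) = β by ring]
  have h2 : ∫ U : Matrix.specialUnitaryGroup (Fin 2) ℂ, Real.exp (β * su2a0 U) * su2a0 U
      ∂haarProbability (Matrix.specialUnitaryGroup (Fin 2) ℂ) =
      (1 / 2) * ∫ U : Matrix.specialUnitaryGroup (Fin 2) ℂ, Real.exp (β * su2a0 U) * (2 * su2a0 U)
        ∂haarProbability (Matrix.specialUnitaryGroup (Fin 2) ℂ) := by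
    rw [← integral_const_mul]
    refine integral_congr_ae (Eventually.of_forall fun U => ?_)
    ring
  rw [h2, h]
  have h1 : su2a0 (1 : Matrix.specialUnitaryGroup (Fin 2) ℂ) = 1 := by
    simp [su2a0, Matrix.trace_one]
  rw [h1]
  norm_num
  ring

/-- **THE FLUX-SECTOR NORM OF THE CIRCLE, EXACTLY**: `‖T ∘ P_{ê₀}‖ = λ^L`, `λ = ∫ e^{β a₀} a₀` the Schur scalar
(`≥`: `TwoDimTorelonBound.pow_schurScalar_le_tubeSectorNorm_sliceOne`; `≤`: this file). [cite: MontvayMunster1994, §3.2.6] -/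
theorem su2_tubeSectorNorm_sliceOne_eq {β : ℝ} (hβ : 0 < β) :
    tubeSectorNorm (fundamentalRep (Fin 2)) su2MinusOne (β / 2) 1 L (Pi.single 0 1) =
      (∫ U : Matrix.specialUnitaryGroup (Fin 2) ℂ, Real.exp (2 * (β / 2) * su2a0 U) * su2a0 U
        ∂haarProbability (Matrix.specialUnitaryGroup (Fin 2) ℂ)) ^ L := by
  haveI : SecondCountableTopology (Matrix.specialUnitaryGroup (Fin 2) ℂ) :=
    Summit.Ventures.LatticeQCDFlow.Scoring.secondCountableTopology_su2
  refine le_antisymm ?_ ?_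
  · rw [su2_schurScalar_eq_besselISub hβ.le]
    exact su2_tubeSectorNorm_sliceOne_le hβ
  · exact pow_schurScalar_le_tubeSectorNorm_sliceOne (fundamentalRep (Fin 2)) (β / 2) (L := L)
      (continuous_fundamentalRep (Fin 2)) two_ne_zero fundamentalRep_su2MinusOne (su2_integral_exp_mul_apply (β / 2))

/-- **THE d = 2 EQUALITY.**  On the circle `(ℤ/L)¹` (theory dimension two) the cell's typed SU(2) torelon energy IS
the exactly solvable value: `su2TorelonEnergy β 1 L 0 = L · (−ln u(β))`, `u(β) = I₂(β)/I₁(β) = su2CharacterRatio β`,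
for every `L ≥ 1` and `β > 0` (STEP-0 in theorem form: `J = β_W/2`, twist `−1`, `E₁ = log ‖T‖ − log ‖T ∘ P_{ê₀}‖`).
[cite: MontvayMunster1994, §3.2.6] -/
theorem su2TorelonEnergy_sliceOne_eq {β : ℝ} (hβ : 0 < β) (L : ℕ) [NeZero L] :
    su2TorelonEnergy β 1 L 0 = (L : ℝ) * (-Real.log (su2CharacterRatio β)) := by
  haveI : SecondCountableTopology (Matrix.specialUnitaryGroup (Fin 2) ℂ) :=
    Summit.Ventures.LatticeQCDFlow.Scoring.secondCountableTopology_su2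
  refine le_antisymm (su2TorelonEnergy_sliceOne_le hβ L) ?_
  -- weight mass and Schur scalar at `J = β/2`; their ratio is `u(β)`
  have hc0 : (∫ g : Matrix.specialUnitaryGroup (Fin 2) ℂ, Real.exp (β / 2 * ((fundamentalRep (Fin 2) g).trace).re)
      ∂haarProbability (Matrix.specialUnitaryGroup (Fin 2) ℂ)) =
      ∫ U : Matrix.specialUnitaryGroup (Fin 2) ℂ, Real.exp (2 * (β / 2) * su2a0 U)
        ∂haarProbability (Matrix.specialUnitaryGroup (Fin 2) ℂ) :=
    integral_congr_ae (Eventually.of_forall fun U => su2_weight_eq (β / 2) U)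
  have hu : (∫ U : Matrix.specialUnitaryGroup (Fin 2) ℂ, Real.exp (2 * (β / 2) * su2a0 U) * su2a0 U
      ∂haarProbability (Matrix.specialUnitaryGroup (Fin 2) ℂ)) /
      (∫ U : Matrix.specialUnitaryGroup (Fin 2) ℂ, Real.exp (2 * (β / 2) * su2a0 U)
        ∂haarProbability (Matrix.specialUnitaryGroup (Fin 2) ℂ)) = su2CharacterRatio β := by
    rw [su2_schurScalar_div_weightMass (β / 2)]
    change Summit.Ventures.LatticeQCDFlow.Scoring.onePlaquetteExpectSU2 (2 * (β / 2)) Real.cos =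
      Summit.Ventures.LatticeQCDFlow.Scoring.onePlaquetteExpectSU2 β Real.cos
    rw [show 2 * (β / 2) = β by ring]
  have hc0pos := su2_weightMass_pos (β / 2)
  have hupos : 0 < su2CharacterRatio β := su2CharacterRatio_pos hβ
  have hlampos : 0 < ∫ U : Matrix.specialUnitaryGroup (Fin 2) ℂ, Real.exp (2 * (β / 2) * su2a0 U) * su2a0 U
      ∂haarProbability (Matrix.specialUnitaryGroup (Fin 2) ℂ) := by
    have h := div_mul_cancel₀ (∫ U : Matrix.specialUnitaryGroup (Fin 2) ℂ, Real.exp (2 * (β / 2) * su2a0 U) * su2a0 U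
      ∂haarProbability (Matrix.specialUnitaryGroup (Fin 2) ℂ)) hc0pos.ne'
    rw [hu] at h
    rw [← h]
    exact mul_pos hupos hc0pos
  -- `E₁ = log ‖T‖ − log ‖T ∘ P₁‖ = L log c₀ − L log λ`
  unfold su2TorelonEnergy torelonEnergy tubeFluxEnergy fluxEnergy
  rw [show sectorNorm (tubeTransferOperator (fundamentalRep (Fin 2)) (β / 2) 1 L) (fluxTwistOp 1 L su2MinusOne)
      (Pi.single 0 1) = tubeSectorNorm (fundamentalRep (Fin 2)) su2MinusOne (β / 2) 1 L (Pi.single 0 1) from rfl,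
    su2_tubeSectorNorm_sliceOne_eq hβ, norm_tubeTransferOperator_sliceOne (fundamentalRep (Fin 2)) (β / 2)
      (continuous_fundamentalRep (Fin 2)) fundamentalRep_mem_unitaryGroup, Real.log_pow, Real.log_pow, hc0,
    ← mul_sub, ← neg_sub, ← Real.log_div hlampos.ne' hc0pos.ne', hu]

/-- **The holonomy characters are eigenvectors of the circle transfer operator**: `T φ_n = (c_n(β)/(n+1))^L φ_n` for
every `n` (`n = 0`: the vacuum `c₀^L`; `n = 1`: the flux sector top `λ^L`). [cite: MontvayMunster1994, §3.2.6] -/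
theorem tubeTransferOperator_holCharacter {β : ℝ} (hβ : 0 < β) (n : ℕ) :
    tubeTransferOperator (fundamentalRep (Fin 2)) (β / 2) 1 L ((memLp_holCharacter (L := L) n).toLp _) =
      (((besselI n β - besselI (n + 2) β) / (n + 1)) ^ L) • (memLp_holCharacter (L := L) n).toLp _ := by
  have h := hasSum_tubeTransferOperator_sliceOne (L := L) hβ ((memLp_holCharacter (L := L) n).toLp _)
  have hon := orthonormal_iff_ite.1 (orthonormal_holCharacter (L := L))
  have h2 := hasSum_single (f := fun m : ℕ => (((besselI m β - besselI (m + 2) β) / (m + 1)) ^ L *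
      @inner ℝ _ _ ((memLp_holCharacter (L := L) m).toLp _) ((memLp_holCharacter (L := L) n).toLp _)) •
        (memLp_holCharacter (L := L) m).toLp _) n (fun m hm => by
    rw [hon m n, if_neg hm, mul_zero, zero_smul])
  rw [hon n n, if_pos rfl, mul_one] at h2
  exact h.unique h2

/-- **At `k = 1` the strict law «E₁ < L·(−ln u)» is FALSE at every point** (it degenerates to the equality): the typed law
`Conjectures.TubeStringTensionLawDim3` is a statement about slice dimension `k = 2`, as its docstring says. [folklore] -/
theorem su2TorelonEnergy_sliceOne_not_lt {β : ℝ} (hβ : 0 < β) (L : ℕ) [NeZero L] :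
    ¬ su2TorelonEnergy β 1 L 0 < (L : ℝ) * (-Real.log (su2CharacterRatio β)) :=
  (su2TorelonEnergy_sliceOne_eq hβ L).not_lt

end Equality

end Summit.Ventures.YMGap.FlowData
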